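import Summits.PneNP.PneNP.Theorems.ConvexRankGatesCliqueExtLowerBoundWidthThresholdDefs
import Summits.PneNP.PneNP.Theorems.ConvexRankGatesCliqueExtLowerBoundWidthThresholdNarrow
import Summits.PneNP.PneNP.Theorems.CliqueExtLowerBound.Negative.Padding
import Literature.Computability.Complexity.CircuitComposition
import Literature.Computability.Complexity.NegationElimination
import Literature.Computability.Complexity.CircuitLowerBoundsProofs
import Mathlib

/-!
# Stub `stub_andThresholdAssembly` of line `width-threshold-certificate-sparsity`
(crux `ConvexRankGates.CliqueExtLowerBound`, stmt-PneNP-10682)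

AN AND OF FEW NON-NEGATIVELY WEIGHTED REAL THRESHOLDS IS SANDWICHABLE. Granted (as hypotheses, the
two neighbouring stubs of the skeleton) Muroga's integer-weight theorem (a non-negative real threshold
function of `n` Boolean variables has non-negative integer weights and threshold `≤ (n+2)!`) and the
monotone `{∧₂,∨₂,0,1}`-circuit of size `≤ 60 (n+L+2)⁴` for an integer threshold with `L`-bit
weights, a gate `φ` computing an AND of `K ≤ (m^c+1)²` non-negatively weighted real threshold
functions of its inputs, fed with local child pairs `D ≤ C` having `≤ m^{c+3}` distinct pairs, is
`(r,s)`-sandwichable on the referee pair with error `1/(8 m^{c+1})` once `r ≥ r₀(c)`, `s ≥ s₀(c)`,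
eventually in `m`.

Proof. MERGE equal child pairs: on both push-forwards `x ↦ D(x)`, `x ↦ C(x)` the wire values are
constant on the `n' ≤ m^{c+3}` classes of equal pairs, so (regrouping the weights class-wise,
`sum_merge`) the gate agrees there with the AND of `K` thresholds of the `n'` class representatives.
Per threshold: integer weights `≤ (n'+2)! < 2^{(n'+2)²}` (hypothesis 1, `factorial_lt_two_pow_sq`),
one monotone circuit of size `≤ 60 (n' + (n'+2)² + 2)⁴` (hypothesis 2) rewired to the representatives
(`CktSize.rewire`); bundle the `K` circuits (`CktSize.pi_const`) and AND their outputs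
(`cktSize_forall`, a chain of `∧₂`'s): a `{∧₂,∨₂,0,1}`-circuit of size
`≤ K · 60 (m^{c+3} + (m^{c+3}+2)² + 2)⁴ + K + 1 ≤ m^{19(2c+5)}` (`size_arith`) agreeing with `φ` on
every `D(x)` and every `C(x)`, i.e. `Replaceable … (m^{19(2c+5)}) … 0 φ` with EMPTY error events;
then the landed currency lemma `sandwichable_of_replaceable` with the landed
`inline_statement (19(2c+5)) c` (`InlineFree` at that monotone complexity) gives error
`0 + 1/(8 m^{c+1})`.

References: S. Muroga, *Threshold logic and its applications* (1971), Thm. 9.3.2.1; S. Jukna,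
*Boolean Function Complexity* (2012), Thm. 9.17 [Jukna2012].
-/

set_option linter.dupNamespace false

open Literature.Computability.Complexity Filter Finset
open Summit.PneNP.PneNP.Theorems.CliqueExtLowerBound.Negative (cktSize_ofCircuit)

noncomputable section

namespace Summit.PneNP.PneNP.Theorems.CliqueExtLowerBound.WidthThreshold.AndThreshold

/-! ## §1 Arithmetic -/

/-- `k! < 2^{k²}` for `k ≥ 1` (so integer weights `≤ k!` have `k²` bits). [folklore] -/
theorem factorial_lt_two_pow_sq {k : ℕ} (hk : 1 ≤ k) : k.factorial < 2 ^ (k ^ 2) :=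
  calc k.factorial ≤ k ^ k := Nat.factorial_le_pow k
    _ < (2 ^ k) ^ k := Nat.pow_lt_pow_left Nat.lt_two_pow_self (by omega)
    _ = 2 ^ (k ^ 2) := by rw [← pow_mul, sq]

/-- The size arithmetic of the assembled circuit: `K · 60 (A + (A+2)² + 2)⁴ + K + 1 ≤ Y¹⁹` once
`K + 1 ≤ Y`, `A + 2 ≤ Y`, `2 ≤ Y`. [folklore] -/
theorem size_arith {K A Y : ℕ} (hK : K + 1 ≤ Y) (hA : A + 2 ≤ Y) (hY : 2 ≤ Y) :
    K * (60 * (A + (A + 2) ^ 2 + 2) ^ 4) + (K + 1) ≤ Y ^ 19 := by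
  have hY2 : Y ≤ Y ^ 2 := Nat.le_self_pow (by norm_num) Y
  have hA2 : (A + 2) ^ 2 ≤ Y ^ 2 := Nat.pow_le_pow_left hA 2
  have h1 : A + (A + 2) ^ 2 + 2 ≤ 2 * Y ^ 2 := by omega
  have h2 : (A + (A + 2) ^ 2 + 2) ^ 4 ≤ 16 * Y ^ 8 :=
    calc (A + (A + 2) ^ 2 + 2) ^ 4 ≤ (2 * Y ^ 2) ^ 4 := Nat.pow_le_pow_left h1 4
      _ = 16 * Y ^ 8 := by ring
  have h9 : Y ≤ Y ^ 9 := Nat.le_self_pow (by norm_num) Y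
  have h10 : 961 ≤ Y ^ 10 :=
    calc 961 ≤ 2 ^ 10 := by norm_num
      _ ≤ Y ^ 10 := Nat.pow_le_pow_left hY 10
  have hKY : K ≤ Y := by omega
  calc K * (60 * (A + (A + 2) ^ 2 + 2) ^ 4) + (K + 1) ≤ Y * (60 * (16 * Y ^ 8)) + Y := by gcongr
    _ = 960 * Y ^ 9 + Y := by ring
    _ ≤ 961 * Y ^ 9 := by omega
    _ ≤ Y ^ 10 * Y ^ 9 := Nat.mul_le_mul_right _ h10
    _ = Y ^ 19 := by rw [← pow_add]

/-- Powers of `m ≥ 2` dominate the parameters: `(m^c+1)² + 1`, `m^{c+3} + 2` and `2` are all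
`≤ m^{2c+5}`. [folklore] -/
theorem pow_dominates {m : ℕ} (hm : 2 ≤ m) (c : ℕ) :
    (m ^ c + 1) ^ 2 + 1 ≤ m ^ (2 * c + 5) ∧ m ^ (c + 3) + 2 ≤ m ^ (2 * c + 5) ∧
      2 ≤ m ^ (2 * c + 5) := by
  have h1 : 1 ≤ m := by omega
  have hc1 : 1 ≤ m ^ c := Nat.one_le_pow _ _ h1
  have e1 : m ^ c + 1 ≤ m ^ (c + 1) := by
    calc m ^ c + 1 ≤ m ^ c * 2 := by omega
      _ ≤ m ^ c * m := Nat.mul_le_mul_left _ hm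
      _ = m ^ (c + 1) := (pow_succ m c).symm
  have e2 : (m ^ c + 1) ^ 2 ≤ m ^ (2 * c + 2) :=
    calc (m ^ c + 1) ^ 2 ≤ (m ^ (c + 1)) ^ 2 := Nat.pow_le_pow_left e1 2
      _ = m ^ (2 * c + 2) := by rw [← pow_mul]; ring_nf
  have h22 : 1 ≤ m ^ (2 * c + 2) := Nat.one_le_pow _ _ h1
  have e3 : (m ^ c + 1) ^ 2 + 1 ≤ m ^ (2 * c + 5) :=
    calc (m ^ c + 1) ^ 2 + 1 ≤ m ^ (2 * c + 2) * 2 := by omega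
      _ ≤ m ^ (2 * c + 2) * m := Nat.mul_le_mul_left _ hm
      _ = m ^ (2 * c + 3) := (pow_succ m _).symm
      _ ≤ m ^ (2 * c + 5) := Nat.pow_le_pow_right h1 (by omega)
  have hm3 : 2 ≤ m ^ (c + 3) := hm.trans (Nat.le_self_pow (by omega) m)
  have e4 : m ^ (c + 3) + 2 ≤ m ^ (2 * c + 5) :=
    calc m ^ (c + 3) + 2 ≤ m ^ (c + 3) * 2 := by omega
      _ ≤ m ^ (c + 3) * m := Nat.mul_le_mul_left _ hm
      _ = m ^ (c + 4) := (pow_succ m _).symm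
      _ ≤ m ^ (2 * c + 5) := Nat.pow_le_pow_right h1 (by omega)
  exact ⟨e3, e4, hm.trans (Nat.le_self_pow (by omega) m)⟩

/-! ## §2 Merging equal wires -/

/-- CLASSES OF EQUAL KEYS: a numbering `cls` of the `#(univ.image key)` distinct keys of the wires
and representatives `rep` carrying the same key. [folklore] -/
theorem exists_classes {n : ℕ} {α : Type*} [DecidableEq α] (key : Fin n → α) :
    ∃ (cls : Fin n → Fin #(univ.image key)) (rep : Fin #(univ.image key) → Fin n),
      ∀ j, key (rep (cls j)) = key j := by
  have hrep : ∀ i : Fin #(univ.image key),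
      ∃ j, key j = ((univ.image key).equivFin.symm i).1 := fun i => by
    obtain ⟨j, -, hj⟩ := mem_image.1 ((univ.image key).equivFin.symm i).2
    exact ⟨j, hj⟩
  choose rep hrep using hrep
  refine ⟨fun j => (univ.image key).equivFin ⟨key j, mem_image_of_mem key (mem_univ j)⟩, rep,
    fun j => ?_⟩
  rw [hrep, Equiv.symm_apply_apply]

/-- REGROUPING a weighted sum of wire values that are constant on classes: with the merged weights
`γ' i = ∑_{cls j = i} γ j`, `∑ⱼ γ j [v j] = ∑ᵢ γ' i [v (rep i)]`. [folklore] -/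
theorem sum_merge {n n' : ℕ} (cls : Fin n → Fin n') (rep : Fin n' → Fin n) (γ : Fin n → ℝ)
    (γ' : Fin n' → ℝ) (hγ' : ∀ i, γ' i = ∑ j ∈ univ.filter (fun j => cls j = i), γ j)
    (v : Fin n → Bool) (hv : ∀ j, v j = v (rep (cls j))) :
    ∑ i, γ' i * (if v (rep i) then (1 : ℝ) else 0) = ∑ j, γ j * (if v j then (1 : ℝ) else 0) :=
  calc ∑ i, γ' i * (if v (rep i) then (1 : ℝ) else 0)
      = ∑ i, ∑ j ∈ univ.filter (fun j => cls j = i),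
          γ j * (if v (rep (cls j)) then (1 : ℝ) else 0) := by
        refine sum_congr rfl fun i _ => ?_
        rw [hγ' i, sum_mul]
        exact sum_congr rfl fun j hj => by rw [(mem_filter.1 hj).2]
    _ = ∑ j, γ j * (if v (rep (cls j)) then (1 : ℝ) else 0) := sum_fiberwise univ cls _
    _ = ∑ j, γ j * (if v j then (1 : ℝ) else 0) := sum_congr rfl fun j _ => by rw [← hv j]

/-! ## §3 Small monotone circuits for ANDs of thresholds -/

/-- The AND of all `K` wires costs `≤ K + 1` gates over `{∧₂,∨₂,0,1}` (a chain of `∧₂`'s; the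
constant `1` when `K = 0`). [folklore] -/
theorem cktSize_forall (K : ℕ) : CktSize monotoneBasis01
    (fun (y : Fin K → Bool) (_ : Unit) => decide (∀ l, y l = true)) (K + 1) := by
  rcases Nat.eq_zero_or_pos K with rfl | hK
  · refine ((CktSize.gate (B := monotoneBasis01) (GateFn.const true) (Set.mem_insert _ _)
      Fin.elim0).of_le (by norm_num)).congr fun y _ => ?_
    simp [GateFn.const]
  · have hne : List.finRange K ≠ [] := by
      intro h
      have := congrArg List.length h
      simp only [List.length_finRange, List.length_nil] at this
      omega
    refine (((cktSize_all (List.finRange K) hne).basis_mono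
      monotoneBasis_subset_monotoneBasis01).of_le (by simp)).congr fun y _ => ?_
    rw [Bool.eq_iff_iff, List.all_eq_true, decide_eq_true_iff]
    exact ⟨fun h l => h l (List.mem_finRange l), fun h l _ => h l⟩

section Assembly

variable
  (hMur : ∀ (n : ℕ) (β : Fin n → ℝ) (h : ℝ), (∀ j, 0 ≤ β j) →
      ∃ (w : Fin n → ℕ) (t : ℕ), (∀ j, w j ≤ (n + 2).factorial) ∧ t ≤ (n + 2).factorial ∧
        ∀ v : Fin n → Bool, (h ≤ ∑ j, β j * (if v j then (1 : ℝ) else 0)) ↔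
          (t ≤ ∑ j, w j * (if v j then 1 else 0)))
  (hCkt : ∀ (n L : ℕ) (w : Fin n → ℕ) (t : ℕ), (∀ j, w j < 2 ^ L) →
      ∃ Ψ : Circuit (Fin n), Ψ.IsOver monotoneBasis01 ∧ Ψ.size ≤ 60 * (n + L + 2) ^ 4 ∧
        ∀ v : Fin n → Bool, Ψ.eval v = decide (t ≤ ∑ j, w j * (if v j then 1 else 0)))
include hMur hCkt

/-- ONE THRESHOLD: a non-negatively weighted real threshold of `n` wires has a
`{∧₂,∨₂,0,1}`-circuit with `≤ 60 (n + (n+2)² + 2)⁴` gates (integer weights `≤ (n+2)! < 2^{(n+2)²}`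
by the first hypothesis, the circuit by the second). [folklore] -/
theorem cktSize_threshold (n : ℕ) (β : Fin n → ℝ) (h : ℝ) (hβ : ∀ j, 0 ≤ β j) :
    CktSize monotoneBasis01
      (fun (u : Fin n → Bool) (_ : Unit) => decide (h ≤ ∑ j, β j * (if u j then (1 : ℝ) else 0)))
      (60 * (n + (n + 2) ^ 2 + 2) ^ 4) := by
  obtain ⟨w, t, hw, -, hiff⟩ := hMur n β h hβ
  have hwL : ∀ j, w j < 2 ^ ((n + 2) ^ 2) := fun j =>
    (hw j).trans_lt (factorial_lt_two_pow_sq (by omega))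
  obtain ⟨Ψ, hΨB, hΨs, hΨe⟩ := hCkt n ((n + 2) ^ 2) w t hwL
  refine ((cktSize_ofCircuit Ψ hΨB).of_le hΨs).congr fun u _ => ?_
  rw [hΨe, decide_eq_decide]
  exact (hiff u).symm

/-- ASSEMBLY ON MERGED WIRES: an AND of `K` non-negatively weighted real thresholds of `n` wires,
restricted to inputs constant along `cls`/`rep` (`v j = v (rep (cls j))`), is computed there by a
`{∧₂,∨₂,0,1}`-circuit with `≤ K · 60 (n' + (n'+2)² + 2)⁴ + K + 1` gates (merge the weights
class-wise, one threshold circuit per row on the `n'` representatives, AND the rows). [folklore] -/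
theorem exists_circuit_merged {n n' K : ℕ} (cls : Fin n → Fin n') (rep : Fin n' → Fin n)
    (f : (Fin n → Bool) → Bool) (β : Fin K → Fin n → ℝ) (h : Fin K → ℝ) (hβ : ∀ l j, 0 ≤ β l j)
    (hf : ∀ v, f v = true ↔ ∀ l, h l ≤ ∑ j, β l j * (if v j then (1 : ℝ) else 0)) :
    ∃ Ψ : Circuit (Fin n), Ψ.IsOver monotoneBasis01 ∧
      Ψ.size ≤ K * (60 * (n' + (n' + 2) ^ 2 + 2) ^ 4) + (K + 1) ∧
      ∀ v : Fin n → Bool, (∀ j, v j = v (rep (cls j))) → Ψ.eval v = f v := by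
  obtain ⟨β', hβ'def⟩ : ∃ β' : Fin K → Fin n' → ℝ,
      ∀ l i, β' l i = ∑ j ∈ univ.filter (fun j => cls j = i), β l j := ⟨_, fun _ _ => rfl⟩
  have hβ' : ∀ l i, 0 ≤ β' l i := fun l i => by
    rw [hβ'def]
    exact sum_nonneg fun j _ => hβ l j
  have h1 : ∀ l, CktSize monotoneBasis01 (fun (v : Fin n → Bool) (_ : Unit) =>
      decide (h l ≤ ∑ i, β' l i * (if v (rep i) then (1 : ℝ) else 0)))
      (60 * (n' + (n' + 2) ^ 2 + 2) ^ 4) := fun l =>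
    (cktSize_threshold hMur hCkt n' (β' l) (h l) (hβ' l)).rewire rep
  have h2 := (CktSize.pi_const (κ := Fin K) (f := fun (v : Fin n → Bool) l =>
      decide (h l ≤ ∑ i, β' l i * (if v (rep i) then (1 : ℝ) else 0))) h1).comp (cktSize_forall K)
  obtain ⟨Ψ, hΨB, hΨs, hΨe⟩ := h2.toCircuit
  refine ⟨Ψ, hΨB, by simpa only [Fintype.card_fin] using hΨs, fun v hv => ?_⟩
  rw [hΨe]
  show decide (∀ l, decide (h l ≤ ∑ i, β' l i * (if v (rep i) then (1 : ℝ) else 0)) = true) = f v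
  rw [Bool.eq_iff_iff, decide_eq_true_iff, hf]
  refine forall_congr' fun l => ?_
  rw [decide_eq_true_iff, sum_merge cls rep (β l) (β' l) (hβ'def l) v hv]

/-- ASSEMBLY (keyed form): if the gate is an AND of `K` non-negatively weighted real thresholds of
its `n` wires and the wires carry keys with `≤ A` distinct values, some `{∧₂,∨₂,0,1}`-circuit with
`≤ K · 60 (A + (A+2)² + 2)⁴ + K + 1` gates agrees with the gate on every input that is constant on
equal keys. [folklore] -/
theorem exists_circuit_andThreshold {n K A : ℕ} {α : Type*} [DecidableEq α] (key : Fin n → α)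
    (hA : #(univ.image key) ≤ A) (f : (Fin n → Bool) → Bool) (β : Fin K → Fin n → ℝ)
    (h : Fin K → ℝ) (hβ : ∀ l j, 0 ≤ β l j)
    (hf : ∀ v, f v = true ↔ ∀ l, h l ≤ ∑ j, β l j * (if v j then (1 : ℝ) else 0)) :
    ∃ Ψ : Circuit (Fin n), Ψ.IsOver monotoneBasis01 ∧
      Ψ.size ≤ K * (60 * (A + (A + 2) ^ 2 + 2) ^ 4) + (K + 1) ∧
      ∀ v : Fin n → Bool, (∀ j j', key j = key j' → v j = v j') → Ψ.eval v = f v := by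
  obtain ⟨cls, rep, hkey⟩ := exists_classes key
  obtain ⟨Ψ, hΨB, hΨs, hΨe⟩ := exists_circuit_merged hMur hCkt cls rep f β h hβ hf
  refine ⟨Ψ, hΨB, hΨs.trans ?_, fun v hv => hΨe v fun j => hv _ _ (hkey j).symm⟩
  gcongr

end Assembly

/-! ## §4 The registered stub -/

open Classical in
/-- **AND OF THRESHOLDS** (registered stub `stub_andThresholdAssembly`). Granted Muroga's
integer-weight statement and the monotone circuit for integer thresholds (the two hypotheses), for
every `c` there are `r₀, s₀ ≥ 2` such that for `r ≥ r₀`, `s ≥ s₀`, eventually in `m`: a gate computing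
an AND of `≤ (m^c+1)²` non-negatively weighted real threshold functions of its inputs, fed with
local child pairs `D ≤ C` with `≤ m^{c+3}` distinct pairs, is `(r,s)`-sandwichable on the referee pair
(bare `⌈m^{1/4}⌉₊`-cliques / complements of the `#E/⌊m^{1/8}⌋₊`-subsets of the edge slots) with
error `1/(8 m^{c+1})` on each side: it is `Replaceable` with error `0` at monotone complexity
`m^{19(2c+5)}` (`exists_circuit_andThreshold` with key `j ↦ (D j, C j)`, `size_arith`), and
`sandwichable_of_replaceable` + `inline_statement (19(2c+5)) c` supply the thresholds `r₀, s₀` and the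
error `0 + 1/(8 m^{c+1})`. [cite: Jukna2012, Thm. 9.17] -/
theorem stub_andThresholdAssembly :
    (∀ (n : ℕ) (β : Fin n → ℝ) (h : ℝ), (∀ j, 0 ≤ β j) →
      ∃ (w : Fin n → ℕ) (t : ℕ), (∀ j, w j ≤ (n + 2).factorial) ∧ t ≤ (n + 2).factorial ∧
        ∀ v : Fin n → Bool, (h ≤ ∑ j, β j * (if v j then (1 : ℝ) else 0)) ↔
          (t ≤ ∑ j, w j * (if v j then 1 else 0))) →
    (∀ (n L : ℕ) (w : Fin n → ℕ) (t : ℕ), (∀ j, w j < 2 ^ L) →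
      ∃ Ψ : Circuit (Fin n), Ψ.IsOver monotoneBasis01 ∧ Ψ.size ≤ 60 * (n + L + 2) ^ 4 ∧
        ∀ v : Fin n → Bool, Ψ.eval v = decide (t ≤ ∑ j, w j * (if v j then 1 else 0))) →
    ∀ c : ℕ, ∃ r₀ s₀ : ℕ, 2 ≤ r₀ ∧ 2 ≤ s₀ ∧ ∀ r s : ℕ, r₀ ≤ r → s₀ ≤ s →
    ∀ᶠ m : ℕ in atTop, ∀ φ : GateFn,
      (∃ (K : ℕ) (β : Fin K → Fin φ.1 → ℝ) (h : Fin K → ℝ), K ≤ (m ^ c + 1) ^ 2 ∧ (∀ l j, 0 ≤ β l j) ∧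
        ∀ v : Fin φ.1 → Bool, φ.2 v = true ↔ ∀ l, h l ≤ ∑ j, β l j * (if v j then (1 : ℝ) else 0)) →
      ∀ (D C : Fin φ.1 → Finset (Finset ((⊤ : SimpleGraph (Fin m)).edgeSet))),
        #(univ.image fun j => (D j, C j)) ≤ m ^ (c + 3) →
        (∀ j, ∀ R ∈ D j, #R ≤ r - 1) → (∀ j, ∀ S ∈ C j, #S ≤ s - 1) →
        (∀ j x, EvalDNF (D j) x → EvalCNF (C j) x) →
        ∃ dnf cnf : Finset (Finset ((⊤ : SimpleGraph (Fin m)).edgeSet)),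
          (∀ R ∈ dnf, #R ≤ r - 1) ∧ (∀ S ∈ cnf, #S ≤ s - 1) ∧
          (∀ x, EvalDNF dnf x → EvalCNF cnf x) ∧
          (#((posGraphs m ⌈(m : ℝ) ^ (1 / 4 : ℝ)⌉₊).filter
              (fun x => φ.2 (fun j => decide (EvalDNF (D j) x)) = true ∧ ¬ EvalDNF dnf x)) : ℝ)
            ≤ (1 / (8 * (m : ℝ) ^ (c + 1))) * #(posGraphs m ⌈(m : ℝ) ^ (1 / 4 : ℝ)⌉₊) ∧
          (#((((powersetCard (Fintype.card ((⊤ : SimpleGraph (Fin m)).edgeSet) / ⌊(m : ℝ) ^ (1 / 8 : ℝ)⌋₊)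
          (univ : Finset ((⊤ : SimpleGraph (Fin m)).edgeSet))).image (fun M => fun e => decide (e ∉ M)))).filter
              (fun x => EvalCNF cnf x ∧ φ.2 (fun j => decide (EvalCNF (C j) x)) = false)) : ℝ)
            ≤ (1 / (8 * (m : ℝ) ^ (c + 1))) *
              #(((powersetCard (Fintype.card ((⊤ : SimpleGraph (Fin m)).edgeSet) / ⌊(m : ℝ) ^ (1 / 8 : ℝ)⌋₊)
          (univ : Finset ((⊤ : SimpleGraph (Fin m)).edgeSet))).image (fun M => fun e => decide (e ∉ M)))) := by
  intro hMur hCkt c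
  obtain ⟨r₀, s₀, hr₀, hs₀, hI⟩ := inline_statement ((2 * c + 5) * 19) c
  refine ⟨r₀, s₀, hr₀, hs₀, fun r s hr hs => ?_⟩
  filter_upwards [hI r s hr hs, eventually_ge_atTop 2] with m hInl hm φ hφ
  have hSand : Sandwichable r s (m ^ (c + 3)) (posFam m) (negFam m) (eps m c) φ := by
    obtain ⟨hKm, hAm, h2m⟩ := pow_dominates hm c
    have hR : Replaceable r s (m ^ (c + 3)) (m ^ ((2 * c + 5) * 19)) (posFam m) (negFam m) 0 φ := by
      intro d e hA _ _ _
      obtain ⟨K, β, h, hK, hβ, hφv⟩ := hφ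
      obtain ⟨Ψ, hΨB, hΨs, hΨe⟩ :=
        exists_circuit_andThreshold hMur hCkt (fun j => (d j, e j)) hA φ.2 β h hβ hφv
      refine ⟨Ψ, hΨB, hΨs.trans ?_, ?_, ?_⟩
      · calc _ ≤ (m ^ c + 1) ^ 2 * (60 * (m ^ (c + 3) + (m ^ (c + 3) + 2) ^ 2 + 2) ^ 4) +
              ((m ^ c + 1) ^ 2 + 1) :=
            Nat.add_le_add (Nat.mul_le_mul_right _ hK) (Nat.add_le_add_right hK 1)
          _ ≤ (m ^ (2 * c + 5)) ^ 19 := size_arith hKm hAm h2m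
          _ = m ^ ((2 * c + 5) * 19) := (pow_mul m _ 19).symm
      · rw [zero_mul]
        refine le_of_eq ?_
        rw [Nat.cast_eq_zero, card_eq_zero, filter_eq_empty_iff]
        intro x _ hx
        obtain ⟨h1, h2⟩ := hx
        rw [hΨe (dval d x) (fun j j' hjj => by
          have hdj : d j = d j' := congrArg Prod.fst hjj
          simp only [dval, hdj]), h1] at h2
        cases h2
      · rw [zero_mul]
        refine le_of_eq ?_
        rw [Nat.cast_eq_zero, card_eq_zero, filter_eq_empty_iff]
        intro x _ hx
        obtain ⟨h1, h2⟩ := hx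
        rw [hΨe (cval e x) (fun j j' hjj => by
          have hej : e j = e j' := congrArg Prod.snd hjj
          simp only [cval, hej])] at h1
        rw [h1] at h2
        cases h2
    have key := sandwichable_of_replaceable hR hInl
    rwa [zero_add] at key
  exact hSand

end Summit.PneNP.PneNP.Theorems.CliqueExtLowerBound.WidthThreshold.AndThreshold

end
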